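import Mathlib.Topology.Algebra.Group.Quotient
import Mathlib.Topology.Algebra.OpenSubgroup
import Mathlib.Topology.Algebra.Category.ProfiniteGrp.Basic
import Literature.AnabelianGeometry.AbsoluteAnabelian.GaloisSubextensionProofs
import Literature.IUT.HodgeTheaters.CoveringsErrata
import HarnessLib

/-!
# Continuity of homomorphisms out of extensions of a topologically finitely generated profinite group,
# via Nikolov–Segal ([SemiAnbd] Def 5.1 (i)(a)(c) / [IUTchI] Rmk 2.5.3 (vi) (O3) mechanism) — pure topology

Mochizuki, *Semi-graphs of anabelioids*, Publ. RIMS **42** (2006), §5 Def 5.1 (i) p. 62 ((a) "`π̂₁(A)` is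
topologically finitely generated", (c) "continuous"), Prop 5.2 (iv) p. 64, Thm 5.4 (iii) p. 66; Mochizuki,
*IUTchI*, Rmk 2.5.3 (vi) (O3) p. 56: "since `H` is topologically finitely generated … it holds [cf. [NS],
Theorem 1.1] that every finite index subgroup of `H` is open in `H` … Thus, the conditions (c) and (c^new) in
fact hold automatically" [cite: MochizukiSemiAnbd2006, Def 5.1 (i), p. 62].

abc-iut cell, D-0079 L-F sub-cell [SemiAnbd]+[CombGC] pack B (row F-1922, Thm 5.4 (iii) at the outer models),
seat abc-iut-w4-d071 (gen 5), helper file H1 of the discharge of the design binder `hcont` (continuity of the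
canonical `B^temp(φ)` between the tempered level topologies) MODULO the named classical fact
`Literature.IUT.HodgeTheaters.Rmk253.FiniteIndexOpenOfTopFG` (= [NS] Thm 1.1, FACT-LIST F-1977).

PURE TOPOLOGICAL GROUP THEORY, no semi-graphs.  Contents:
* `compactSpace_quotient_of_isOpenMap` — an extension of a compact space by a subgroup `M` that is a
  FINITE union of cosets of a normal subgroup `K` has compact quotient `E ⧸ K` (tube argument along an
  open map `aug : E → P` whose fibres are `M`-cosets);
* `isPreconnected_subsingleton_of_finite`, `totallyDisconnectedSpace_of_finite_fibers` — a `T₁` space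
  mapping continuously with finite fibres to a totally disconnected space is totally disconnected;
* `isTopologicallyFinitelyGenerated_of_surjective_of_finite_ker` — a compact group mapping onto a
  topologically finitely generated Hausdorff group with finite kernel is topologically finitely generated;
* `isOpen_of_finiteIndex_quotient` — THE (O3) MECHANISM: inside an open subgroup `O`, a subgroup `S ⊇ K`
  of finite index is OPEN as soon as `O ⧸ K` is a topologically finitely generated profinite group and
  [NS] holds (`FiniteIndexOpenOfTopFG`, taken BY NAME as a hypothesis — a conditional use of F-1977);
* `continuous_of_preimage_mem_nhds_of_hasBasis` — a homomorphism of topological groups is continuous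
  once the preimages of a neighbourhood basis of `1` are neighbourhoods of `1`.
Nothing here bears on [IUTchIII] Cor. 3.12; nothing is asserted about [NS] (it is a hypothesis).
-/

namespace Literature.AnabelianGeometry.SemiGraphs

namespace ArithContinuity

open Topology Filter
open Literature.AnabelianGeometry.AbsoluteAnabelian

universe u v w

/-! ### Compactness of `E ⧸ K` for a finite-by-compact extension -/

section Compact

variable {E : Type u} [Group E] [TopologicalSpace E] [IsTopologicalGroup E]
  {P : Type v} [TopologicalSpace P] [CompactSpace P]

/-- **Finite-by-compact is compact.**  Let `K ⊴ E` and `M ≤ E` with `M` contained in finitely many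
left cosets `t K` (`t ∈ T`), and let `aug : E → P` be an OPEN surjection onto a compact space whose fibres
are contained in `M`-cosets (`aug x = aug y → x⁻¹ y ∈ M`).  Then `E ⧸ K` is compact.  (For each `a = aug xₐ`
the finitely many classes `[xₐ t]`, `t ∈ T`, exhaust the image of the fibre; a finite intersection of right
translates of the covering sets is an open `A ∋ xₐ` with `aug⁻¹(aug A)` inside finitely many covering sets;
compactness of `P` finishes.) [cite: MochizukiSemiAnbd2006, Prop 5.2 (iv), p. 64] -/
theorem compactSpace_quotient_of_isOpenMap (K M : Subgroup E) [K.Normal] (T : Finset E)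
    (hMT : ∀ m ∈ M, ∃ t ∈ T, ∃ k ∈ K, m = t * k) (aug : E → P) (haug : IsOpenMap aug)
    (hsurj : Function.Surjective aug) (hfib : ∀ x y : E, aug x = aug y → x⁻¹ * y ∈ M) :
    CompactSpace (E ⧸ K) := by
  classical
  refine ⟨isCompact_of_finite_subcover fun {ι} U hUo hcov => ?_⟩
  -- for every `x : E` and `t ∈ T`, an index covering `[x t]`
  have hidx : ∀ z : E, ∃ i : ι, (QuotientGroup.mk z : E ⧸ K) ∈ U i := fun z =>
    Set.mem_iUnion.mp (hcov (Set.mem_univ _))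
  choose idx hidx using hidx
  -- the open set `A x := ⋂_{t ∈ T} {z | [z t] ∈ U (idx (x t))}` contains `x`
  let A : E → Set E := fun x => ⋂ t ∈ T, (fun z => (QuotientGroup.mk (z * t) : E ⧸ K)) ⁻¹' U (idx (x * t))
  have hAopen : ∀ x, IsOpen (A x) := fun x =>
    isOpen_biInter_finset fun t _ =>
      (hUo _).preimage (QuotientGroup.continuous_mk.comp (continuous_id.mul continuous_const))
  have hxA : ∀ x, x ∈ A x := fun x => Set.mem_iInter₂.mpr fun t _ => hidx (x * t)
  -- saturation: `aug z ∈ aug '' (A x)` ⇒ `[z] ∈ U (idx (x t))` for some `t ∈ T`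
  have hsat : ∀ x z, aug z ∈ aug '' A x → ∃ t ∈ T, (QuotientGroup.mk z : E ⧸ K) ∈ U (idx (x * t)) := by
    intro x z hz
    obtain ⟨y, hy, hyz⟩ := hz
    obtain ⟨t, ht, k, hk, hm⟩ := hMT _ (hfib y z hyz)
    refine ⟨t, ht, ?_⟩
    have hz' : z = y * t * k := by
      rw [mul_assoc, ← hm, mul_inv_cancel_left]
    have hcl : (QuotientGroup.mk (y * t) : E ⧸ K) = QuotientGroup.mk z := by
      rw [hz', QuotientGroup.eq, ← mul_assoc, inv_mul_cancel, one_mul]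
      exact hk
    rw [← hcl]
    exact Set.mem_iInter₂.mp hy t ht
  -- compactness of `P`: finitely many `aug '' (A x)` cover
  have hPcov : (Set.univ : Set P) ⊆ ⋃ x : E, aug '' A x := by
    intro a _
    obtain ⟨x, rfl⟩ := hsurj a
    exact Set.mem_iUnion.mpr ⟨x, x, hxA x, rfl⟩
  obtain ⟨F, hF⟩ := isCompact_univ.elim_finite_subcover (fun x : E => aug '' A x)
    (fun x => haug _ (hAopen x)) hPcov
  refine ⟨F.biUnion fun x => T.image fun t => idx (x * t), ?_⟩
  rintro q -
  obtain ⟨z, rfl⟩ := QuotientGroup.mk_surjective q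
  obtain ⟨x, hxF, hz⟩ : ∃ x ∈ F, aug z ∈ aug '' A x := by
    simpa only [Set.mem_iUnion, exists_prop] using hF (Set.mem_univ (aug z))
  obtain ⟨t, ht, hmem⟩ := hsat x z hz
  refine Set.mem_iUnion₂.mpr ⟨idx (x * t), ?_, hmem⟩
  exact Finset.mem_biUnion.mpr ⟨x, hxF, Finset.mem_image.mpr ⟨t, ht, rfl⟩⟩

end Compact

/-! ### Total disconnectedness from finite fibres -/

section TotallyDisconnected

variable {X : Type u} [TopologicalSpace X] {Y : Type v} [TopologicalSpace Y]

/-- In a `T₁` space a finite preconnected set is a subsingleton (a finite set is closed, so a point of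
it and its complement in it are both relatively clopen). [cite: MochizukiSemiAnbd2006, Prop 5.2 (iv), p. 64] -/
theorem isPreconnected_subsingleton_of_finite [T1Space X] {S : Set X} (hS : IsPreconnected S)
    (hfin : S.Finite) : S.Subsingleton := by
  intro x hx y hy
  by_contra hxy
  -- `u := (S \ {x})ᶜ`, `v := {x}ᶜ` are open, cover `S`, and are disjoint on `S`
  have hu : IsOpen (S \ {x})ᶜ := (hfin.subset fun z hz => hz.1).isClosed.isOpen_compl
  have hv : IsOpen ({x}ᶜ : Set X) := isClosed_singleton.isOpen_compl
  have hcov : S ⊆ (S \ {x})ᶜ ∪ {x}ᶜ := by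
    intro z _
    by_cases hzx : z = x
    · left
      subst hzx
      intro h
      exact h.2 rfl
    · right
      exact hzx
  have hdisj : S ∩ ((S \ {x})ᶜ ∩ {x}ᶜ) = ∅ := by
    apply Set.eq_empty_of_forall_notMem
    rintro z ⟨hz, h1, h2⟩
    exact h1 ⟨hz, h2⟩
  rcases (isPreconnected_iff_subset_of_disjoint.mp hS) _ _ hu hv hcov hdisj with h | h
  · exact (h hy) ⟨hy, fun h' => hxy (Set.mem_singleton_iff.mp h').symm⟩
  · exact (h hx) rfl

/-- **Finite fibres over a totally disconnected space.**  A `T₁` space admitting a continuous map with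
finite fibres to a totally disconnected space is totally disconnected.
[cite: MochizukiSemiAnbd2006, Prop 5.2 (iv), p. 64] -/
theorem totallyDisconnectedSpace_of_finite_fibers [T1Space X] [TotallyDisconnectedSpace Y] (f : X → Y)
    (hf : Continuous f) (hfib : ∀ y : Y, (f ⁻¹' {y}).Finite) : TotallyDisconnectedSpace X := by
  refine ⟨fun S _ hS => ?_⟩
  have himg : (f '' S).Subsingleton := (hS.image f hf.continuousOn).subsingleton
  rcases S.eq_empty_or_nonempty with h | ⟨x, hx⟩
  · subst h; exact Set.subsingleton_empty
  · have hSf : S ⊆ f ⁻¹' {f x} := fun z hz => himg ⟨z, hz, rfl⟩ ⟨x, hx, rfl⟩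
    exact isPreconnected_subsingleton_of_finite hS ((hfib (f x)).subset hSf)

end TotallyDisconnected

/-! ### Topological finite generation of a finite-kernel extension -/

section TFG

variable {Q : Type u} [Group Q] [TopologicalSpace Q] [IsTopologicalGroup Q] [CompactSpace Q]
  {P : Type v} [Group P] [TopologicalSpace P] [IsTopologicalGroup P] [T2Space P]

/-- **A compact group mapping onto a topologically finitely generated Hausdorff group with finite kernel
is topologically finitely generated**: lifts of dense generators together with the kernel generate a
CLOSED (compact) subgroup `C ⊇ ker π` whose image is compact, hence closed, hence everything; so `C = Q`.
[cite: MochizukiSemiAnbd2006, Def 5.1 (i)(a), p. 62] -/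
theorem isTopologicallyFinitelyGenerated_of_surjective_of_finite_ker (π : Q →ₜ* P)
    (hπ : Function.Surjective π) (hker : (π.ker : Set Q).Finite) (hP : IsTopologicallyFinitelyGenerated P) :
    IsTopologicallyFinitelyGenerated Q := by
  classical
  obtain ⟨s, hs⟩ := hP.exists_finset
  -- lifts of the generators
  choose lift hlift using fun p : P => hπ p
  let S : Finset Q := s.image lift ∪ hker.toFinset
  refine ⟨⟨S, ?_⟩⟩
  set C : Subgroup Q := (Subgroup.closure (S : Set Q)).topologicalClosure with hC
  -- `ker π ≤ C`
  have hkerC : π.ker ≤ C := by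
    intro k hk
    refine Subgroup.le_topologicalClosure _ (Subgroup.subset_closure ?_)
    rw [Finset.coe_union]
    exact Or.inr (by simpa using hk)
  -- `π '' C` is closed and contains the dense subgroup generated by `s`
  have hCcl : IsClosed (C : Set Q) := Subgroup.isClosed_topologicalClosure _
  have hπC_closed : IsClosed (π '' (C : Set Q)) := (hCcl.isCompact.image (map_continuous π)).isClosed
  have hsC : (Subgroup.closure (s : Set P) : Set P) ⊆ π '' (C : Set Q) := by
    change Subgroup.closure (s : Set P) ≤ C.map π.toMonoidHom
    rw [Subgroup.closure_le]
    intro p hp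
    refine ⟨lift p, Subgroup.le_topologicalClosure _ (Subgroup.subset_closure ?_), hlift p⟩
    rw [Finset.coe_union, Finset.coe_image]
    exact Or.inl ⟨p, hp, rfl⟩
  have hπC : π '' (C : Set Q) = Set.univ := by
    apply Set.eq_univ_of_univ_subset
    have h1 : ((Subgroup.closure (s : Set P)).topologicalClosure : Set P) ⊆ π '' (C : Set Q) := by
      rw [Subgroup.topologicalClosure_coe]
      exact closure_minimal hsC hπC_closed
    rw [hs] at h1
    simpa using h1
  -- hence `C = ⊤`
  rw [eq_top_iff]
  intro q _
  obtain ⟨c, hc, hcq⟩ : π q ∈ π '' (C : Set Q) := by rw [hπC]; trivial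
  have hk : c⁻¹ * q ∈ π.ker := by
    rw [MonoidHom.mem_ker, map_mul, map_inv]
    change (π c)⁻¹ * π q = 1
    rw [hcq, inv_mul_cancel]
  have := C.mul_mem hc (hkerC hk)
  rwa [mul_inv_cancel_left] at this

end TFG

/-! ### The (O3) mechanism: finite-index subgroups above a profinite t.f.g. quotient are open -/

section NS

variable {E : Type u} [Group E] [TopologicalSpace E] [IsTopologicalGroup E]

/-- **Nikolov–Segal applied inside an open subgroup.**  Let `O ≤ E` be an open subgroup, `K ≤ O` a
subgroup normal in `O` such that `O ⧸ K` (quotient topology) is compact, totally disconnected and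
topologically finitely generated, and assume [NS] (`FiniteIndexOpenOfTopFG`: finite-index subgroups of
topologically finitely generated profinite groups are open).  Then every subgroup `S` with `K ≤ S ≤ O` of
finite index in `O` is OPEN in `E`. [cite: MochizukiSemiAnbd2006, Def 5.1 (i)(c), p. 62] -/
theorem isOpen_of_finiteIndex_quotient (O : Subgroup E) (hO : IsOpen (O : Set E)) (K : Subgroup O)
    [K.Normal] [CompactSpace (O ⧸ K)] [TotallyDisconnectedSpace (O ⧸ K)]
    (htfg : IsTopologicallyFinitelyGenerated (O ⧸ K))
    (hNS : Literature.IUT.HodgeTheaters.Rmk253.FiniteIndexOpenOfTopFG.{u})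
    (S : Subgroup E) (hKS : K.map O.subtype ≤ S) (hSO : S ≤ O) [(S.subgroupOf O).FiniteIndex] :
    IsOpen (S : Set E) := by
  -- the image of `S ∩ O` in `Q := O ⧸ K` has finite index, hence is open by [NS]
  let SQ : Subgroup (O ⧸ K) := (S.subgroupOf O).map (QuotientGroup.mk' K)
  -- (the index of the image divides the index)
  have hidx : SQ.index ≠ 0 := fun h0 =>
    (S.subgroupOf O).index_ne_zero_of_finite
      (Nat.eq_zero_of_zero_dvd (h0 ▸ Subgroup.index_map_dvd _ (QuotientGroup.mk'_surjective K)))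
  haveI : SQ.FiniteIndex := ⟨hidx⟩
  have hSQ : IsOpen (SQ : Set (O ⧸ K)) := hNS (ProfiniteGrp.of (O ⧸ K)) htfg SQ inferInstance
  -- its preimage in `O` is `S ∩ O` (since `K ≤ S`)
  have hpre : (QuotientGroup.mk' K) ⁻¹' (SQ : Set (O ⧸ K)) = (S.subgroupOf O : Set O) := by
    ext x
    constructor
    · rintro ⟨y, hy, hyx⟩
      have hk : y⁻¹ * x ∈ K := by
        rw [← QuotientGroup.eq]; exact hyx
      have hkS : ((y⁻¹ * x : O) : E) ∈ S := hKS ⟨y⁻¹ * x, hk, rfl⟩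
      have : ((y : O) : E) * ((y⁻¹ * x : O) : E) ∈ S := S.mul_mem hy hkS
      simpa [Subgroup.mem_subgroupOf] using this
    · intro hx
      exact ⟨x, hx, rfl⟩
  have hSO' : IsOpen ((S.subgroupOf O : Subgroup O) : Set O) := by
    rw [← hpre]
    exact hSQ.preimage QuotientGroup.continuous_mk
  -- `S = S ∩ O` is open in `E` (`O` is open)
  have himg : (S : Set E) = ((↑) : O → E) '' (S.subgroupOf O : Set O) := by
    ext x
    simp only [Set.mem_image, SetLike.mem_coe, Subgroup.mem_subgroupOf]
    constructor
    · intro hx; exact ⟨⟨x, hSO hx⟩, hx, rfl⟩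
    · rintro ⟨y, hy, rfl⟩; exact hy
  rw [himg]
  exact hO.isOpenEmbedding_subtypeVal.isOpenMap _ hSO'

end NS

/-! ### Continuity of a homomorphism from a neighbourhood basis -/

section Continuity

variable {E : Type u} [Group E] [TopologicalSpace E] [IsTopologicalGroup E]
  {E' : Type v} [Group E'] [TopologicalSpace E'] [IsTopologicalGroup E']

/-- A homomorphism of topological groups is continuous once the preimage of every member of a basis of
neighbourhoods of `1` is a neighbourhood of `1`. [cite: MochizukiSemiAnbd2006, Thm 5.4 (iii), p. 66] -/
theorem continuous_of_preimage_mem_nhds_of_hasBasis {ι : Sort w} {p : ι → Prop} {V : ι → Set E'}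
    (hB : (𝓝 (1 : E')).HasBasis p V) (B : E →* E') (h : ∀ i, p i → B ⁻¹' V i ∈ 𝓝 (1 : E)) :
    Continuous B := by
  refine continuous_of_continuousAt_one B ?_
  change Tendsto B (𝓝 1) (𝓝 (B 1))
  rw [map_one, hB.tendsto_right_iff]
  intro i hi
  exact h i hi

end Continuity

end ArithContinuity

end Literature.AnabelianGeometry.SemiGraphs
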